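import Mathlib.GroupTheory.Index
import Mathlib.GroupTheory.OrderOfElement
import Mathlib.GroupTheory.QuotientGroup.Basic
import Mathlib.GroupTheory.Coset.Card
import Mathlib.Algebra.Group.Subgroup.Finite
import Mathlib.Data.ZMod.Basic
import Mathlib.Tactic
import HarnessLib

/-!
# Slabs of a lattice quotient along an integer functional: parity separation and the count per slab

Topic `Literature/InformationTheory/QuantumCodes` (venture QEC, cell `qec`, PARTITION row 06 / X1). The finite
combinatorics behind the proof of the Bravyi–Terhal bound on `ℤ^D/Λ` [ArnaultEtAl2026, Thm. 3.6]
(`LatticeQuotientDistanceBound.lean`), isolated from the geometry: the values of an integer functional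
`x ↦ ⟨x, w⟩ mod n` on the `n` vertices of `ℤ^D/Λ` are read through a homomorphism `χ : V → ℤ/n` of a finite
abelian group of order `n`; the value circle `ℤ/n` is cut into an EVEN number `μ` of consecutive slabs
`⌊μ·val/n⌋`. Everything is PROVED; no definitions, no named facts.

* `slab_eq_of_parity_eq` — two integers at distance `≤ n/μ` have residues in equal-or-adjacent slabs, hence equal
  slabs when the parities agree (the wrap-around pair `(μ−1, 0)` has different parities because `μ` is even):
  the separation hypothesis of the tree's cyclic slab / Cleaning-Lemma core `sympDual_le_of_slabs'`
  (`LocalCodeDistanceBoundPeriodic.lean`).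
* `card_filter_slab_le` — a slab holds at most `⌊n/μ⌋ + |ker χ|` vertices (the image of `χ` lies in the subgroup
  of multiples of `g = |ker χ|`; at most `⌊(n/g)/μ⌋ + 1` of them fall in one slab, `card_filter_mul_div_eq_le`;
  fibres have `≤ g` elements — private helpers).

References: F. Arnault, P. Gaborit, W. Rozendaal, N. Saussay, G. Zémor, *A Variant of the Bravyi–Terhal Bound for
Arbitrary Boundary Conditions*, IEEE Trans. Inform. Theory 72 (2026) 437–446 = arXiv:2502.04995 [ArnaultEtAl2026],
§3.4 Lemmas 3.10–3.13 (chunks p0007–p0009).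
-/

namespace Literature.InformationTheory.QuantumCodes

namespace LatticeQuotient

open Finset

/-! ### Blocks of indices, subgroups of `ℤ/n`, slab parity -/

/-- **Indices in one block.** Among `t < q`, those with `⌊μt/q⌋ = j` number at most `⌊q/μ⌋ + 1` (they form an
integer interval on which `μ t` varies by less than `q`). Used with `t` = the index of a value of the slab
functional. [cite: ArnaultEtAl2026, §3.4 Lemma 3.11 (arXiv:2502.04995 chunk p0008 L9–25: the count of vertices in a parallelotope)] -/
theorem card_filter_mul_div_eq_le (q μ j : ℕ) (hμ : 0 < μ) :
    #((range q).filter (fun t => μ * t / q = j)) ≤ q / μ + 1 := by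
  rcases Nat.eq_zero_or_pos q with rfl | hq
  · simp
  set T := (range q).filter (fun t => μ * t / q = j) with hT
  rcases T.eq_empty_or_nonempty with hE | hne
  · rw [hE]; simp
  · obtain ⟨t₀, ht₀⟩ := hne
    have ht₀' := (mem_filter.1 ht₀).2
    -- every `t ∈ T` satisfies `|t - t₀| ≤ q / μ`; inject `t ↦ t - t₀ + q / μ`? use `t - tmin`
    let tmin := T.min' ⟨t₀, ht₀⟩
    have htmin : tmin ∈ T := T.min'_mem _
    have htmin' := (mem_filter.1 htmin).2
    have key : ∀ t ∈ T, t - tmin ≤ q / μ := by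
      intro t ht
      have hle : tmin ≤ t := T.min'_le t ht
      have ht' := (mem_filter.1 ht).2
      -- `μ t < (j+1) q` and `j q ≤ μ tmin`
      have h1 : μ * t < (j + 1) * q := by
        have := Nat.lt_succ_iff.2 (le_of_eq ht')
        rw [Nat.div_lt_iff_lt_mul hq] at this
        exact this
      have h2 : j * q ≤ μ * tmin := by
        have := (le_of_eq htmin'.symm)
        rw [Nat.le_div_iff_mul_le hq] at this
        exact this
      have h3 : μ * (t - tmin) < q := by
        rw [Nat.mul_sub]
        have h1' : μ * t < j * q + q := by simpa [add_mul] using h1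
        omega
      rw [Nat.le_div_iff_mul_le hμ]
      have : (t - tmin) * μ < q := by rw [mul_comm]; exact h3
      omega
    calc #T ≤ #(range (q / μ + 1)) := by
          refine Finset.card_le_card_of_injOn (fun t => t - tmin) (fun t ht => ?_) ?_
          · rw [coe_range, Set.mem_Iio]
            exact Nat.lt_succ_of_le (key t ht)
          · intro t ht t' ht' h
            have h1 : tmin ≤ t := T.min'_le t ht
            have h2 : tmin ≤ t' := T.min'_le t' ht'
            simp only at h
            omega
      _ = q / μ + 1 := card_range _

/-- Lagrange in `ℤ/n`: `|H| · (n/|H|) = n` for a subgroup `H ≤ ℤ/n`. [folklore] -/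
private theorem card_mul_div_card_eq {n : ℕ} [NeZero n] (H : AddSubgroup (ZMod n)) :
    Nat.card H * (n / Nat.card H) = n := by
  have hdvd : Nat.card H ∣ n := by
    have := AddSubgroup.card_addSubgroup_dvd_card H
    rwa [Nat.card_zmod] at this
  exact Nat.mul_div_cancel' hdvd

/-- **A subgroup of `ℤ/n` consists of multiples of `n/|H|`**: `x ∈ H ⟹ (n/|H|) ∣ x.val` (from `|H| • x = 0`).
[folklore] -/
private theorem div_card_dvd_val_of_mem {n : ℕ} [NeZero n] (H : AddSubgroup (ZMod n)) {x : ZMod n}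
    (hx : x ∈ H) : (n / Nat.card H) ∣ x.val := by
  have hH : 0 < Nat.card H := Nat.card_pos
  have h1 : Nat.card H • x = 0 := by
    have : Nat.card H • (⟨x, hx⟩ : H) = 0 := card_nsmul_eq_zero'
    exact congrArg Subtype.val this
  have h2 : (n : ℕ) ∣ Nat.card H * x.val := by
    rw [← ZMod.natCast_eq_zero_iff, Nat.cast_mul, ZMod.natCast_zmod_val, ← nsmul_eq_mul]
    exact h1
  have h3 : Nat.card H * (n / Nat.card H) ∣ Nat.card H * x.val := by
    rw [card_mul_div_card_eq H]; exact h2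
  exact Nat.dvd_of_mul_dvd_mul_left hH h3

/-- **Slab parity** (the arithmetic of [ArnaultEtAl2026, Lemma 3.12] on the value circle `ℤ/n`). Cut the residues
`0 ≤ r < n` into `μ` cyclically consecutive slabs `⌊μr/n⌋ ∈ {0,…,μ−1}`, `μ` EVEN. If two integers `a, a'` satisfy
`μ·|a − a'| ≤ n`, their residues lie in the same slab or in cyclically adjacent slabs — which have different
parities, the pair `(μ−1, 0)` included — so equal parity forces the same slab.
[cite: ArnaultEtAl2026, §3.4 Lemma 3.12 and the choice of an even μ (arXiv:2502.04995 chunk p0009 L29–42)] -/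
theorem slab_eq_of_parity_eq {n μ : ℕ} [NeZero n] (hμe : Even μ) (hμ : 0 < μ) {a a' : ℤ}
    (hδ : (μ : ℤ) * |a - a'| ≤ n)
    (hpar : (μ * (a : ZMod n).val / n) % 2 = (μ * (a' : ZMod n).val / n) % 2) :
    μ * (a : ZMod n).val / n = μ * (a' : ZMod n).val / n := by
  have hn : 0 < n := Nat.pos_of_ne_zero (NeZero.ne n)
  -- the residues
  set r : ℕ := (a : ZMod n).val with hr
  set r' : ℕ := (a' : ZMod n).val with hr'
  have hrn : r < n := ZMod.val_lt _
  have hrn' : r' < n := ZMod.val_lt _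
  have hra : (r : ℤ) = a % n := by rw [hr, ZMod.val_intCast]
  have hra' : (r' : ℤ) = a' % n := by rw [hr', ZMod.val_intCast]
  -- `r - r' - (a - a') = n * z` with `z ∈ {-1, 0, 1}`
  obtain ⟨z, hz⟩ : ∃ z : ℤ, (r : ℤ) - r' - (a - a') = n * z := by
    refine ⟨a' / n - a / n, ?_⟩
    rw [hra, hra', Int.emod_def, Int.emod_def]
    ring
  have hz1 : -2 < z ∧ z < 2 := by
    have h1 : |(r : ℤ) - r'| < n := by rw [abs_lt]; constructor <;> omega
    have h2 : 2 * |a - a'| ≤ n := by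
      have : (2 : ℤ) ≤ μ := by
        obtain ⟨t, ht⟩ := hμe
        omega
      nlinarith [abs_nonneg (a - a')]
    have h3 : |(n : ℤ) * z| < 2 * n := by
      rw [← hz]
      calc |(r : ℤ) - r' - (a - a')| ≤ |(r : ℤ) - r'| + |a - a'| := abs_sub _ _
        _ < n + n := by linarith
        _ = 2 * n := by ring
    rw [abs_mul, Nat.abs_cast] at h3
    have hn' : (0 : ℤ) < n := by exact_mod_cast hn
    have : |z| < 2 := by
      by_contra h
      push Not at h
      have : (2 : ℤ) * n ≤ n * |z| := by nlinarith
      linarith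
    rw [abs_lt] at this
    exact this
  -- slabs
  set s : ℕ := μ * r / n with hs
  set s' : ℕ := μ * r' / n with hs'
  have hsμ : s < μ := by
    rw [hs, Nat.div_lt_iff_lt_mul hn]; exact Nat.mul_lt_mul_of_pos_left hrn hμ
  have hsμ' : s' < μ := by
    rw [hs', Nat.div_lt_iff_lt_mul hn]; exact Nat.mul_lt_mul_of_pos_left hrn' hμ
  obtain ⟨μ2, hμ2⟩ := hμe
  -- monotone / +1 facts for natural slabs
  have mono : ∀ {u v : ℕ}, u ≤ v → μ * u / n ≤ μ * v / n :=
    fun h => Nat.div_le_div_right (Nat.mul_le_mul_left _ h)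
  have succ : ∀ {u v : ℕ}, (μ : ℤ) * ((v : ℤ) - u) ≤ n → μ * v / n ≤ μ * u / n + 1 := by
    intro u v h
    have h' : μ * v ≤ μ * u + n := by
      have : (μ : ℤ) * v ≤ μ * u + n := by linarith
      exact_mod_cast this
    calc μ * v / n ≤ (μ * u + n) / n := Nat.div_le_div_right h'
      _ = μ * u / n + 1 := Nat.add_div_right _ hn
  have small : ∀ {u : ℕ}, (μ : ℤ) * u < n → μ * u / n = 0 := by
    intro u h
    have : μ * u < n := by exact_mod_cast h
    exact Nat.div_eq_of_lt this
  have big : ∀ {u : ℕ}, u < n → (μ : ℤ) * n - n ≤ μ * u → μ * u / n = μ - 1 := by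
    intro u hun h
    have h' : (μ - 1) * n ≤ μ * u := by
      have : ((μ : ℤ) - 1) * n ≤ μ * u := by linarith
      have hμ1 : 1 ≤ μ := hμ
      have : (((μ - 1 : ℕ) : ℤ)) * n ≤ μ * u := by push_cast [hμ1]; linarith
      exact_mod_cast this
    have hlo : μ - 1 ≤ μ * u / n := (Nat.le_div_iff_mul_le hn).2 h'
    have hhi : μ * u / n < μ := by
      rw [Nat.div_lt_iff_lt_mul hn]; exact Nat.mul_lt_mul_of_pos_left hun hμ
    omega
  rcases (show z = -1 ∨ z = 0 ∨ z = 1 by omega) with rfl | rfl | rfl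
  · -- `r - r' = (a - a') - n`: then `a - a' > 0`... so `r' ≥ r`, wrap
    have h1 : (r : ℤ) - r' = (a - a') - n := by linarith
    -- `a - a' = n + r - r' ≥ 1` (since `r - r' > -n`) and `μ (a - a') ≤ n`
    have hpos : 0 < a - a' := by omega
    have habs : |a - a'| = a - a' := abs_of_pos hpos
    rw [habs] at hδ
    -- `μ r < n` and `μ n - n ≤ μ r'`
    have e1 : (μ : ℤ) * r < n := by nlinarith
    have e2 : (μ : ℤ) * n - n ≤ μ * r' := by nlinarith
    have hs0 : s = 0 := small e1
    have hs1 : s' = μ - 1 := big hrn' e2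
    rw [hs0, hs1] at hpar
    omega
  · -- no wrap: `r - r' = a - a'`
    have h1 : (r : ℤ) - r' = a - a' := by linarith
    rcases le_total r r' with hle | hle
    · have e : (μ : ℤ) * ((r' : ℤ) - r) ≤ n := by
        have : |a - a'| = r' - r := by rw [← h1, abs_sub_comm]; exact abs_of_nonneg (by omega)
        rw [this] at hδ; exact hδ
      have a1 := mono hle
      have a2 := succ e
      omega
    · have e : (μ : ℤ) * ((r : ℤ) - r') ≤ n := by
        have : |a - a'| = r - r' := by rw [← h1]; exact abs_of_nonneg (by omega)
        rw [this] at hδ; exact hδ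
      have a1 := mono hle
      have a2 := succ e
      omega
  · -- `r - r' = (a - a') + n`: then `a' - a > 0`, `r ≥ r'`, wrap the other way
    have h1 : (r : ℤ) - r' = (a - a') + n := by linarith
    have hpos : 0 < a' - a := by omega
    have habs : |a - a'| = a' - a := by rw [abs_sub_comm]; exact abs_of_pos hpos
    rw [habs] at hδ
    have e1 : (μ : ℤ) * r' < n := by nlinarith
    have e2 : (μ : ℤ) * n - n ≤ μ * r := by nlinarith
    have hs0 : s' = 0 := small e1
    have hs1 : s = μ - 1 := big hrn e2
    rw [hs0, hs1] at hpar
    omega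


/-! ### Counting vertices per slab through a homomorphism to `ZMod n` -/

section Count

variable {V : Type*} [AddCommGroup V] [Fintype V] {n : ℕ} [NeZero n]

omit [NeZero n] in
/-- Fibres of a homomorphism of finite groups are no larger than its kernel (translate into the kernel).
[folklore] -/
private theorem card_filter_eq_le_card_ker (χ : V →+ ZMod n) (c : ZMod n) :
    #(univ.filter fun v : V => χ v = c) ≤ Nat.card χ.ker := by
  classical
  rcases (univ.filter fun v : V => χ v = c).eq_empty_or_nonempty with hE | ⟨v₀, hv₀⟩
  · rw [hE]; simp
  · have hv₀' : χ v₀ = c := (mem_filter.1 hv₀).2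
    have hker : Nat.card χ.ker = #(univ.filter fun v : V => χ v = 0) := by
      rw [← Fintype.card_subtype, ← Nat.card_eq_fintype_card]
      exact Nat.card_congr (Equiv.subtypeEquivRight fun v => χ.mem_ker)
    rw [hker]
    refine Finset.card_le_card_of_injOn (fun v => v - v₀) (fun v hv => ?_) ?_
    · have hv' : χ v = c := (mem_filter.1 hv).2
      simp [hv', hv₀']
    · intro v _ v' _ h
      simpa using h

omit [NeZero n] in
/-- Index arithmetic: `val = g t`, `n = q g` ⟹ `⌊μ·val/n⌋ = ⌊μt/q⌋`. [folklore] -/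
private theorem mul_div_eq_of_eq_mul (μ g q n val t : ℕ) (hg : 0 < g) (hval : val = g * t)
    (hn : q * g = n) : μ * val / n = μ * t / q := by
  subst hval; subst hn
  rw [show μ * (g * t) = g * (μ * t) by ring, mul_comm q g, Nat.mul_div_mul_left _ _ hg]

/-- **Vertices per slab.** Let `V` be a finite abelian group of order `n` and `χ : V → ℤ/n` a homomorphism with
kernel of order `g` (so the image is the subgroup of order `n/g`, i.e. the multiples of `g`). Then `g` divides
every value `(χ v).val`, `g ∣ n`, and for every `μ ≥ 1` and `j` the slab `{v : ⌊μ·(χ v).val/n⌋ = j}` has at most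
`⌊n/μ⌋ + g` elements: each of the `≤ ⌊(n/g)/μ⌋ + 1` admissible values has a fibre of size `≤ g`. This is the
integral-point count of [ArnaultEtAl2026, Lemma 3.11] `|(ℤ^D ∩ T_k)/Λ| ≤ (n/‖u*_D‖)(λ + √D)` in group-theoretic
form (with `g ≤ n/‖u*_D‖ = ‖w‖` supplied by the caller, and `1` in place of `√D`).
[cite: ArnaultEtAl2026, §3.4 Lemma 3.11 (arXiv:2502.04995 chunk p0008 L9–25)] -/
theorem card_filter_slab_le (χ : V →+ ZMod n) (hV : Nat.card V = n) {μ : ℕ} (hμ : 0 < μ)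
    (j : ℕ) :
    (∀ v, Nat.card χ.ker ∣ (χ v).val) ∧ Nat.card χ.ker ∣ n ∧
      #(univ.filter fun v : V => μ * (χ v).val / n = j) ≤ n / μ + Nat.card χ.ker := by
  classical
  set g := Nat.card χ.ker with hg
  set H := χ.range with hH
  have hHg : Nat.card H * g = n := by
    have h1 := AddSubgroup.card_eq_card_quotient_mul_card_addSubgroup χ.ker
    have h2 : Nat.card (V ⧸ χ.ker) = Nat.card H :=
      Nat.card_congr (QuotientAddGroup.quotientKerEquivRange χ).toEquiv
    rw [hV, h2] at h1
    exact h1.symm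
  have hgpos : 0 < g := Nat.card_pos
  have hHpos : 0 < Nat.card H := Nat.card_pos
  have hq : n / Nat.card H = g := by
    have := Nat.mul_div_cancel_left g hHpos
    rwa [hHg] at this
  have hgdiv : ∀ v : V, g ∣ (χ v).val := by
    intro v
    have := div_card_dvd_val_of_mem H (x := χ v) ⟨v, rfl⟩
    rwa [hq] at this
  refine ⟨hgdiv, ⟨Nat.card H, by rw [mul_comm]; exact hHg.symm⟩, ?_⟩
  set q := Nat.card H with hqdef
  set S := univ.filter fun v : V => μ * (χ v).val / n = j with hSdef
  set T := (range q).filter fun t => μ * t / q = j with hTdef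
  have hval : ∀ v : V, (χ v).val = g * ((χ v).val / g) := fun v =>
    Nat.eq_mul_of_div_eq_right (hgdiv v) rfl
  have hmap : (S : Set V).MapsTo (fun v => (χ v).val / g) T := by
    intro v hv
    have hv' : μ * (χ v).val / n = j := (mem_filter.1 hv).2
    rw [coe_filter]
    refine ⟨mem_range.2 ?_, ?_⟩
    · have h1 : (χ v).val < n := ZMod.val_lt _
      exact (Nat.div_lt_iff_lt_mul hgpos).2 (h1.trans_eq hHg.symm)
    · exact (mul_div_eq_of_eq_mul μ g q n _ _ hgpos (hval v) hHg).symm.trans hv'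
  calc #S = ∑ t ∈ T, #(S.filter fun v => (χ v).val / g = t) := card_eq_sum_card_fiberwise hmap
    _ ≤ ∑ t ∈ T, g := by
        refine Finset.sum_le_sum fun t _ => ?_
        calc #(S.filter fun v => (χ v).val / g = t)
            ≤ #(univ.filter fun v : V => χ v = ((g * t : ℕ) : ZMod n)) := by
              refine card_le_card fun v hv => ?_
              rw [mem_filter] at hv ⊢
              refine ⟨mem_univ _, ?_⟩
              rw [← ZMod.natCast_zmod_val (χ v), hval v, hv.2]
          _ ≤ g := card_filter_eq_le_card_ker χ _
    _ = #T * g := by rw [sum_const, smul_eq_mul]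
    _ ≤ (q / μ + 1) * g := Nat.mul_le_mul_right _ (card_filter_mul_div_eq_le q μ j hμ)
    _ = g * (q / μ) + g := by ring
    _ ≤ g * q / μ + g := Nat.add_le_add_right (Nat.mul_div_le_mul_div_assoc g q μ) _
    _ = n / μ + g := by rw [mul_comm g q, hHg]

end Count


end LatticeQuotient

end Literature.InformationTheory.QuantumCodes
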